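import Literature.MathematicalPhysics.QuantumFieldTheory.Balaban1983to89.B13TransportedLiftLetters
import Literature.MathematicalPhysics.QuantumFieldTheory.Balaban1983to89.B9Eq369Product

/-!
# `Balaban1983to89.B13OpsYPencilLetters` — T. Bałaban, *Propagators for lattice gauge theories in a background field*, Commun. Math. Phys.
# **99** (1985) 389–434 [Balaban1985BackgroundPropagators], (3.3) p. 390 (`D_U`), (3.4)–(3.5) p. 391 (the covariant plaquette derivative, reversed
# bonds), (3.8)–(3.9) p. 392 (the adjoints `D*_U` and of the curl), p. 390 and p. 396 before (3.37) («U = U′U₀, U′ = exp iηA′»), Thm 3.4 p. 400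
# («the operators … extend to configurations U′U … as analytic functions of A′»), (3.50) p. 400 («an analytic function of A(b)»), Thm 3.10 (3.108)
# p. 416; *RG approach … II. Cluster expansions*, Commun. Math. Phys. **116** (1988) 1–22 [Balaban1988RG2Cluster] (2.5) p. 12, p. 15: THM 3.4's
# SENTENCE FOR THE FOUR LOCAL DIFFERENTIAL LETTERS `D_U`, `D*_U`, the covariant curl and its adjoint AT NODE 00's OPERATORS OF RECORD
# `Node00.gradY ∕ divY ∕ curlY ∕ coCurlY` (`Node00/OpsYDeltaA`) ALONG pv27's GROUP PENCIL `A′ ↦ prodCfg U₀ η A′ = e^{iηA′}·U₀` (`B9Eq39Adjoint.prodCfg`),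
# IN THE N10 COORDINATE CURRENCY of `B13TransportedLiftLetters`: holomorphy in `A′` on every chart ball, explicit bounds, kernel range, identification.

statement-level complex analysis ([folklore], all of it inside `B13TransportedLiftLetters` and `B13PolynomialRangeLetters`) AT NODE 00's
`rfl`-level definitions (`gradT`, `curlT`, `gradY`, `divY`, `curlY`, `coCurlY`) and pv27's pencil (`prodCfg`, `val_prodCfg`, `val_inv_prodCfg`); kernel-checked;
THEOREMS ONLY (no `def`, no `structure`, no instance, no notation); NOTHING of NODE 00's ∕ pv27's is modified — consumed BY NAME; nothing here is a
claim about the Yang–Mills mass gap; no node is discharged; count-neutral.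

WHY THIS FILE (cell `pub-ymgap`, HUMAN RULING D-0062 ∕ D-0149, Track A node N10 = [B13]; seat `pub-ymgap-dag-n10-c` g14, INTENT-2; census
`HOME/pub-ymgap-dag-n10-c/N10-RESIDUAL-CENSUS-v15.md` item 1 «NODE 00 ∕ def-Y: the complexified formulas of the LOCAL operators on the chart at the
record's members ⇒ … ⇒ `hEL` for local pieces BY NAME»).  CENSUS CORRECTION: the lane's v12–v15 censuses wrote «the complex chart of a member's
configurations (class A0) is NOT in the tree» — WRONG: pv27's `B9Eq39Adjoint.prodCfg U₀ η A′ = fluct η A′ · U₀` («U = U′U₀», with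
`B9Eq369Product.val_prodCfg ∕ val_inv_prodCfg`) IS that chart (`A′ : Fin (d+1) → Site → 𝔸` = n06-c's `AfldY 𝔸 i`; its coded `decY (prod U a) =
mulY i (fluct η a) U` is the same configuration), a complex normed space on which NODE 00's configurations-to-operators maps can be read.  Module
`B13TransportedLiftLetters` (g14 INTENT-1, p593027) reads NODE 00's one operator constructor `trLiftY M T` along ANY unit-valued transporter family
with pencil values `exp(L_{yx}u)·V(y,x)`; THIS FILE shows that NODE 00's transporter ASSIGNMENTS `gradT i U` ((3.3): the far end of a bond transported by
`U(b)`, the near end by `1`) and `curlT i U` ((3.4): two edges of `∂p` transported by `U_μ(x)`, `U_ν(x)`, two by `1`) HAVE pencil values along `prodCfg`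
(§1), hence (§2) the four facts `B13TransportedLiftLetters` §2–§3 consume — values and inverses holomorphic on every ball `‖A′‖ < R`, bounded by
`K₀e^{|η|R}` once `‖U₀(b)^{±1}‖ ≤ K₀`, `1 ≤ K₀` —, hence (§3) for each of the four letters: every coordinate
`A′ ↦ M(y,x)·φ_k(R(T(A′)(y,x)) e_l)` of `gradY ∕ divY ∕ curlY ∕ coCurlY` at `prodCfg U₀ η A′` is holomorphic on the ball with the displayed bound, vanishes
where the flat kernel `gradK ∕ divK ∕ curlK ∕ cocurlK` does, and IS `φ_k` of the letter applied to `δ_x ⊗ e_l`.  The `hEL` of a LOCAL PIECE of the N10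
operator built from these letters is then letter algebra (`B13EntryLetterAlgebra(Family)`) over this file — the remaining local letters `QY ∕ QsY ∕ QpY ∕
QpsY` ride on the record's contour transporters `parB ∕ parS` (words: `B13TransportedLiftLetters.rawEntryLetters_trLift_word` once the genuine
`Node00/OpsYTransport` transporters are unfolded to words; not here).

WHAT THIS FILE PROVES (all `theorem`s; `𝔸` NODE 00's complete normed `ℂ`-algebra with `‖1‖ = 1`; member index `i : KIdx …`; chart space
`Fin (d+1) → Site (PV …) 0 → 𝔸`).
* §0 THE PENCIL's OWN LETTERS `A′ ↦ (e^{iηA′}U₀)_μ(x)` and inverse: `exists_pencil_prodCfg` (the reading `A′ ↦ iη·A′_μ(x)`, norm `≤ |η|`, in the `hT` shape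
  of `B13TransportedLiftLetters` §4), `differentiableOn_prodCfg_apply ∕ _inv_apply`, `norm_prodCfg_apply_le ∕ _inv_apply_le` (`≤ K₀e^{|η|R}`) — the atoms
  every NODE 00 letter along the pencil is built from (holonomies, edge transports: successor modules).
* §1 PENCIL VALUES OF THE TRANSPORTER ASSIGNMENTS: `gradT_prodCfg` (`gradT i (prodCfg U₀ η A′) b z = exp(1_{z = b₊}·iη·A′(b)) · gradT i U₀ b z`),
  `gradT_inv_prodCfg` (`… ⁻¹ = (gradT i U₀ b z)⁻¹ · exp(−1_{z = b₊}·iη·A′(b))`), `curlT_prodCfg`, `curlT_inv_prodCfg` (the same on `∂p`'s two transported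
  edges); the readings as continuous linear maps of `A′` with norm `≤ |η|`: `exists_pencil_gradT`, `exists_pencil_curlT` (∃ `L` with `‖L_{yx}‖ ≤ |η|` and the
  `hT` binder of `B13TransportedLiftLetters` §4 — its pencil theorems apply verbatim); `norm_gradT_le ∕ norm_gradT_inv_le ∕ norm_curlT_le ∕ norm_curlT_inv_le`
  (the background assignment is bounded by `K₀` once `‖U₀(b)^{±1}‖ ≤ K₀`, `1 ≤ K₀`).
* §2 THE FOUR FACTS PER ASSIGNMENT along the pencil (`T(A′) := gradT i (prodCfg U₀ η A′)`, resp. `curlT`): `differentiableOn_gradT_prodCfg`,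
  `differentiableOn_gradT_inv_prodCfg`, `norm_gradT_prodCfg_le`, `norm_gradT_inv_prodCfg_le` (`≤ K₀e^{|η|R}` on `‖A′‖ < R`), and the `curlT` four.
* §3 ★ THE LETTERS' COORDINATES ALONG THE PENCIL (N10 currency; `φ_k : 𝔸 →L[ℂ] ℂ`, probes `e_l`): for `gradY` (3.3): `differentiableOn_coord_gradY_prodCfg`,
  `norm_coord_gradY_prodCfg_le` (`≤ |gradK(b,z)|·‖φ_k‖·(K₀e^{|η|R}·‖e_l‖·K₀e^{|η|R})`), `coord_gradY_prodCfg_eq` (`= φ_k((gradY i (prodCfg U₀ η A′))(δ_z ⊗ e_l))(b)`);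
  for `divY` (3.8) (INVERTED transporters): `differentiableOn_coord_divY_prodCfg`, `norm_coord_divY_prodCfg_le`, `coord_divY_prodCfg_eq`; for `curlY` (3.4):
  `differentiableOn_coord_curlY_prodCfg`, `norm_coord_curlY_prodCfg_le`, `coord_curlY_prodCfg_eq`; for `coCurlY` (3.9): `differentiableOn_coord_coCurlY_prodCfg`,
  `norm_coord_coCurlY_prodCfg_le`, `coord_coCurlY_prodCfg_eq`.  Ranges are the flat kernels' by `B13TransportedLiftLetters.coord_trLift_eq_zero_of_kernel`
  (generic; not restated).
* §4 THE REAL POINT: `prodCfg_zero'` (`prodCfg U₀ η 0 = U₀`: at `A′ = 0` every statement above is about NODE 00's letter AT THE BACKGROUND `U₀`).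
HONEST FRAMING: NODE 00's DEFINITIONS read along pv27's DEFINITION of the pencil; the only inputs are the background's size `K₀` and the chart radius;
which `U₀`, `η`, index `i`, coordinates and probes the N10 operator of record uses is NODE 00's ∕ def-T's; the square N10 operator's `hEL` needs the
algebra over these rectangular letters and the inverse pieces (N06's Thm 3.10, road 58 ∕ 58B) — NOT here; N06 ∕ N10 NOT discharged; K1⁷ NOT closed;
counts unmoved (typed 28∕28 · discharged 5∕27); no `sorry`, no new named fact; standard axioms; one finite 𝕋⁴ programme at fixed ε, Bałaban AS PRINTED;
the YM mass gap (Clay) is NOT proved by any of this — R4 closes the conditional finite-𝕋⁴ rung `BalabanLadder.UV` only; nothing continuum ∕ ℝ⁴ ∕ OS.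

References: T. Bałaban, CMP 99 (1985) 389–434 [Balaban1985BackgroundPropagators] (3.3) p.390, (3.4)–(3.5) p.391, (3.8)–(3.9) p.392, p.396,
Thm 3.4 and (3.50) p.400, (3.108) p.416; CMP 116 (1988) 1–22 [Balaban1988RG2Cluster] (2.5) p.12, p.15.
-/

noncomputable section

namespace Literature.MathematicalPhysics.QuantumFieldTheory.Balaban1983to89.B13OpsYPencilLetters

open Metric Set Complex
open NormedSpace (exp)
open Literature.MathematicalPhysics.QuantumFieldTheory.Balaban1983to89
open Literature.MathematicalPhysics.QuantumFieldTheory.Balaban1983to89.B9Eq39Adjoint (R prodCfg)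
open Literature.MathematicalPhysics.QuantumFieldTheory.Balaban1983to89.B9Eq369Product (val_prodCfg)
open Literature.MathematicalPhysics.QuantumFieldTheory.Balaban1983to89.B6GlobalChartV1 (PV boxEquiv)
open Literature.MathematicalPhysics.QuantumFieldTheory.Balaban1983to89.B6KLevelCensusIndexV1 (KIdx)
open Literature.MathematicalPhysics.QuantumFieldTheory.Balaban1983to89.Node00
  (SiteY FBondY PlaqY CfgY gradT curlT gradK divK curlK cocurlK gradY divY curlY coCurlY)
open Literature.MathematicalPhysics.QuantumFieldTheory.Balaban1983to89.B13TransportedLiftLetters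
  (units_inv_eq_of_eq_exp_mul differentiableOn_pencil differentiableOn_pencil_inv norm_pencil_le norm_pencil_inv_le
    differentiableOn_coord_trLift norm_coord_trLift_le coord_trLift_eq_coord_trLiftY)

variable {d ℓ : ℕ} {hd : 1 ≤ d + 1} {hL : Odd (ℓ + 1) ∧ 1 < ℓ + 1} {b₀ b₁ : ℝ}
variable {𝔸 : Type} [NormedRing 𝔸] [NormedAlgebra ℂ 𝔸] [CompleteSpace 𝔸]
variable (i : KIdx d ℓ hd hL b₀ b₁)

/-! ## §0. The pencil's own letters: `A′ ↦ (e^{iηA′}U₀)_μ(x)` and its inverse — reading, holomorphy, bounds -/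

section PencilOwn

variable (U₀ : CfgY 𝔸 i) (η : ℝ) {Rc K₀ : ℝ}

omit [CompleteSpace 𝔸] in
/-- The evaluation `A′ ↦ c·A′_μ(x)` on the chart space, as a continuous linear map, has norm `≤ ‖c‖` (plumbing: the sup norm dominates each
component). [folklore] -/
private theorem norm_smul_eval_le (c : ℂ) (μ : Fin (d + 1)) (x : Site (PV d ℓ i.m i.K hd hL) 0) :
    ‖c • ((ContinuousLinearMap.proj (R := ℂ) (φ := fun _ : Site (PV d ℓ i.m i.K hd hL) 0 => 𝔸) x).comp
        (ContinuousLinearMap.proj (R := ℂ) (φ := fun _ : Fin (d + 1) => Site (PV d ℓ i.m i.K hd hL) 0 → 𝔸) μ))‖ ≤ ‖c‖ := by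
  refine ContinuousLinearMap.opNorm_le_bound _ (norm_nonneg c) fun a => ?_
  change ‖c • a μ x‖ ≤ ‖c‖ * ‖a‖
  rw [norm_smul]
  exact mul_le_mul_of_nonneg_left ((norm_le_pi_norm (a μ) x).trans (norm_le_pi_norm a μ)) (norm_nonneg c)

omit [NormedAlgebra ℂ 𝔸] [CompleteSpace 𝔸] in
/-- `‖iη‖ = |η|` and `‖0‖ ≤ |η|` (plumbing for the indicator coefficients). [folklore] -/
private theorem norm_ite_Iη_le (P : Prop) [Decidable P] : ‖(if P then (I * η : ℂ) else 0)‖ ≤ |η| := by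
  split_ifs
  · rw [norm_mul, Complex.norm_I, one_mul, Complex.norm_real, Real.norm_eq_abs]
  · rw [norm_zero]; exact abs_nonneg η

/-- **THE PENCIL's READING**: there is a reading `L : directions → sites → (chart →L[ℂ] 𝔸)` of norm `≤ |η|` (namely `A′ ↦ iη·A′_μ(x)`) with
`(prodCfg U₀ η A′)_μ(x) = exp(L_{μx}A′)·U₀μ(x)` — pv27's `val_prodCfg` in the `hT` shape of `B13TransportedLiftLetters` §4 (`Y := directions`,
`X := sites`, background assignment `U₀` itself). [cite: Balaban1985BackgroundPropagators, p.390 («U = U′U₀»), p.396 («U′ = exp iηA′»), Thm 3.4 p.400] -/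
theorem exists_pencil_prodCfg :
    ∃ L : Fin (d + 1) → Site (PV d ℓ i.m i.K hd hL) 0 → ((Fin (d + 1) → Site (PV d ℓ i.m i.K hd hL) 0 → 𝔸) →L[ℂ] 𝔸),
      (∀ μ x, ‖L μ x‖ ≤ |η|) ∧ ∀ a μ x, (prodCfg U₀ η a μ x : 𝔸) = exp (L μ x a) * (U₀ μ x : 𝔸) := by
  refine ⟨fun μ x => (I * η : ℂ) •
      ((ContinuousLinearMap.proj (R := ℂ) (φ := fun _ : Site (PV d ℓ i.m i.K hd hL) 0 => 𝔸) x).comp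
        (ContinuousLinearMap.proj (R := ℂ) (φ := fun _ : Fin (d + 1) => Site (PV d ℓ i.m i.K hd hL) 0 → 𝔸) μ)),
    fun μ x => (norm_smul_eval_le i _ μ x).trans (le_of_eq ?_), fun a μ x => val_prodCfg U₀ η a μ x⟩
  rw [norm_mul, Complex.norm_I, one_mul, Complex.norm_real, Real.norm_eq_abs]

/-- `A′ ↦ (e^{iηA′}U₀)_μ(x)` is holomorphic on every ball. [cite: Balaban1985BackgroundPropagators, p.390, Thm 3.4 p.400] -/
theorem differentiableOn_prodCfg_apply (μ : Fin (d + 1)) (x : Site (PV d ℓ i.m i.K hd hL) 0) :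
    DifferentiableOn ℂ (fun a => (prodCfg U₀ η a μ x : 𝔸)) (ball (0 : Fin (d + 1) → Site (PV d ℓ i.m i.K hd hL) 0 → 𝔸) Rc) := by
  obtain ⟨L, -, hT⟩ := exists_pencil_prodCfg i U₀ η
  exact differentiableOn_pencil L U₀ (fun a => prodCfg U₀ η a) hT μ x

/-- `A′ ↦ (e^{iηA′}U₀)_μ(x)⁻¹ = U₀μ(x)⁻¹·e^{−iηA′_μ(x)}` is holomorphic on every ball. [cite: Balaban1985BackgroundPropagators, (3.5) p.391, Thm 3.4 p.400] -/
theorem differentiableOn_prodCfg_inv_apply (μ : Fin (d + 1)) (x : Site (PV d ℓ i.m i.K hd hL) 0) :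
    DifferentiableOn ℂ (fun a => (((prodCfg U₀ η a μ x)⁻¹ : 𝔸ˣ) : 𝔸))
      (ball (0 : Fin (d + 1) → Site (PV d ℓ i.m i.K hd hL) 0 → 𝔸) Rc) := by
  obtain ⟨L, -, hT⟩ := exists_pencil_prodCfg i U₀ η
  exact differentiableOn_pencil_inv L U₀ (fun a => prodCfg U₀ η a) hT μ x

variable [NormOneClass 𝔸]

/-- On `‖A′‖ < R`: `‖(e^{iηA′}U₀)_μ(x)‖ ≤ K₀e^{|η|R}` once `‖U₀μ(x)‖ ≤ K₀`. [cite: Balaban1985BackgroundPropagators, (3.35)–(3.37) p.396, Thm 3.4 p.400] -/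
theorem norm_prodCfg_apply_le (hU : ∀ μ x, ‖(U₀ μ x : 𝔸)‖ ≤ K₀) (hRc : 0 ≤ Rc) :
    ∀ a ∈ ball (0 : Fin (d + 1) → Site (PV d ℓ i.m i.K hd hL) 0 → 𝔸) Rc, ∀ μ x,
      ‖(prodCfg U₀ η a μ x : 𝔸)‖ ≤ K₀ * Real.exp (|η| * Rc) := by
  obtain ⟨L, hL, hT⟩ := exists_pencil_prodCfg i U₀ η
  exact norm_pencil_le L U₀ (fun a => prodCfg U₀ η a) hT hL hU hRc

/-- On `‖A′‖ < R`: `‖(e^{iηA′}U₀)_μ(x)⁻¹‖ ≤ K₀e^{|η|R}` once `‖U₀μ(x)⁻¹‖ ≤ K₀`. [cite: Balaban1985BackgroundPropagators, (3.5) p.391, (3.35)–(3.37) p.396] -/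
theorem norm_prodCfg_inv_apply_le (hUi : ∀ μ x, ‖(((U₀ μ x)⁻¹ : 𝔸ˣ) : 𝔸)‖ ≤ K₀) (hRc : 0 ≤ Rc) :
    ∀ a ∈ ball (0 : Fin (d + 1) → Site (PV d ℓ i.m i.K hd hL) 0 → 𝔸) Rc, ∀ μ x,
      ‖(((prodCfg U₀ η a μ x)⁻¹ : 𝔸ˣ) : 𝔸)‖ ≤ K₀ * Real.exp (|η| * Rc) := by
  obtain ⟨L, hL, hT⟩ := exists_pencil_prodCfg i U₀ η
  exact norm_pencil_inv_le L U₀ (fun a => prodCfg U₀ η a) hT hL hUi hRc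

end PencilOwn

/-! ## §1. Pencil values of NODE 00's transporter assignments `gradT`, `curlT` along `prodCfg U₀ η A′` -/

section Values

variable (U₀ : CfgY 𝔸 i) (η : ℝ)

open Classical in
/-- **(3.3) ALONG THE PENCIL**: the gradient's transporter assignment at `U = e^{iηA′}U₀` is the pencil value `exp(1_{z = b₊}·iη·A′(b)) · gradT i U₀ b z`
(the far end of the bond is transported by `U(b) = e^{iηA′(b)}U₀(b)`, the near end by `1 = e^{0}·1`). [cite: Balaban1985BackgroundPropagators, (3.3) p.390, p.396 («U′ = exp iηA′»), Thm 3.4 p.400] -/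
theorem gradT_prodCfg (a : Fin (d + 1) → Site (PV d ℓ i.m i.K hd hL) 0 → 𝔸) (b : FBondY i) (z : SiteY i) :
    (gradT i (prodCfg U₀ η a) b z : 𝔸) =
      exp ((if z = boxEquiv i.hN b.tgt then (I * η : ℂ) else 0) • a b.dir b.src) * (gradT i U₀ b z : 𝔸) := by
  unfold gradT
  split_ifs with h
  · exact val_prodCfg U₀ η a b.dir b.src
  · rw [zero_smul, NormedSpace.exp_zero, Units.val_one, mul_one]

open Classical in
/-- … and its inverse is `(gradT i U₀ b z)⁻¹ · exp(−1_{z = b₊}·iη·A′(b))` (the reversed bond, (3.5)). [cite: Balaban1985BackgroundPropagators, (3.5) p.391, Thm 3.4 p.400] -/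
theorem gradT_inv_prodCfg (a : Fin (d + 1) → Site (PV d ℓ i.m i.K hd hL) 0 → 𝔸) (b : FBondY i) (z : SiteY i) :
    (((gradT i (prodCfg U₀ η a) b z)⁻¹ : 𝔸ˣ) : 𝔸) =
      (((gradT i U₀ b z)⁻¹ : 𝔸ˣ) : 𝔸) * exp (-((if z = boxEquiv i.hN b.tgt then (I * η : ℂ) else 0) • a b.dir b.src)) :=
  units_inv_eq_of_eq_exp_mul (gradT_prodCfg i U₀ η a b z)

open Classical in
/-- **(3.4) ALONG THE PENCIL**: the curl's transporter assignment at `U = e^{iηA′}U₀` is the pencil value: on `p = ⟨x, x+e_μ, x+e_μ+e_ν, x+e_ν⟩` the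
edge at `x+e_μ` carries `exp(iηA′_μ(x))·U₀μ(x)`, the edge at `x+e_ν` carries `exp(iηA′_ν(x))·U₀ν(x)`, the two edges at `x` carry `1`.
[cite: Balaban1985BackgroundPropagators, (3.4) p.391, (3.2) p.390, Thm 3.4 p.400] -/
theorem curlT_prodCfg (a : Fin (d + 1) → Site (PV d ℓ i.m i.K hd hL) 0 → 𝔸) (p : PlaqY i) (b : FBondY i) :
    (curlT i (prodCfg U₀ η a) p b : 𝔸) =
      exp ((if b = ⟨p.src.shift p.μ, p.ν⟩ then (I * η : ℂ) • a p.μ p.src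
            else if b = ⟨p.src.shift p.ν, p.μ⟩ then (I * η : ℂ) • a p.ν p.src else 0)) * (curlT i U₀ p b : 𝔸) := by
  unfold curlT
  split_ifs with h1 h2
  · exact val_prodCfg U₀ η a p.μ p.src
  · exact val_prodCfg U₀ η a p.ν p.src
  · rw [NormedSpace.exp_zero, Units.val_one, mul_one]

open Classical in
/-- … and its inverse (the reversed edges, (3.5)). [cite: Balaban1985BackgroundPropagators, (3.5) p.391, (3.4) p.391, Thm 3.4 p.400] -/
theorem curlT_inv_prodCfg (a : Fin (d + 1) → Site (PV d ℓ i.m i.K hd hL) 0 → 𝔸) (p : PlaqY i) (b : FBondY i) :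
    (((curlT i (prodCfg U₀ η a) p b)⁻¹ : 𝔸ˣ) : 𝔸) =
      (((curlT i U₀ p b)⁻¹ : 𝔸ˣ) : 𝔸) *
        exp (-(if b = ⟨p.src.shift p.μ, p.ν⟩ then (I * η : ℂ) • a p.μ p.src
              else if b = ⟨p.src.shift p.ν, p.μ⟩ then (I * η : ℂ) • a p.ν p.src else 0)) :=
  units_inv_eq_of_eq_exp_mul (curlT_prodCfg i U₀ η a p b)

open Classical in
/-- **THE GRADIENT's PENCIL READING**: there is a reading `L : bonds → sites → (chart →L[ℂ] 𝔸)` of norm `≤ |η|` with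
`gradT i (prodCfg U₀ η A′) b z = exp(L_{bz}A′) · gradT i U₀ b z` for all `A′` — the `hT` binder of `B13TransportedLiftLetters` §4 for the family
`A′ ↦ gradT i (prodCfg U₀ η A′)` over the background assignment `gradT i U₀`. [cite: Balaban1985BackgroundPropagators, (3.3) p.390, Thm 3.4 and (3.50) p.400] -/
theorem exists_pencil_gradT :
    ∃ L : FBondY i → SiteY i → ((Fin (d + 1) → Site (PV d ℓ i.m i.K hd hL) 0 → 𝔸) →L[ℂ] 𝔸),
      (∀ b z, ‖L b z‖ ≤ |η|) ∧
        ∀ a b z, (gradT i (prodCfg U₀ η a) b z : 𝔸) = exp (L b z a) * (gradT i U₀ b z : 𝔸) := by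
  refine ⟨fun b z => (if z = boxEquiv i.hN b.tgt then (I * η : ℂ) else 0) •
      ((ContinuousLinearMap.proj (R := ℂ) (φ := fun _ : Site (PV d ℓ i.m i.K hd hL) 0 => 𝔸) b.src).comp
        (ContinuousLinearMap.proj (R := ℂ) (φ := fun _ : Fin (d + 1) => Site (PV d ℓ i.m i.K hd hL) 0 → 𝔸) b.dir)),
    fun b z => (norm_smul_eval_le i _ b.dir b.src).trans (norm_ite_Iη_le η _), fun a b z => ?_⟩
  rw [gradT_prodCfg]
  rfl

open Classical in
/-- **THE CURL's PENCIL READING**: a reading `L : plaquettes → bonds → (chart →L[ℂ] 𝔸)` of norm `≤ |η|` with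
`curlT i (prodCfg U₀ η A′) p b = exp(L_{pb}A′) · curlT i U₀ p b`. [cite: Balaban1985BackgroundPropagators, (3.4) p.391, Thm 3.4 p.400] -/
theorem exists_pencil_curlT :
    ∃ L : PlaqY i → FBondY i → ((Fin (d + 1) → Site (PV d ℓ i.m i.K hd hL) 0 → 𝔸) →L[ℂ] 𝔸),
      (∀ p b, ‖L p b‖ ≤ |η|) ∧
        ∀ a p b, (curlT i (prodCfg U₀ η a) p b : 𝔸) = exp (L p b a) * (curlT i U₀ p b : 𝔸) := by
  refine ⟨fun p b =>
      if b = ⟨p.src.shift p.μ, p.ν⟩ then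
        (I * η : ℂ) • ((ContinuousLinearMap.proj (R := ℂ) (φ := fun _ : Site (PV d ℓ i.m i.K hd hL) 0 => 𝔸) p.src).comp
          (ContinuousLinearMap.proj (R := ℂ) (φ := fun _ : Fin (d + 1) => Site (PV d ℓ i.m i.K hd hL) 0 → 𝔸) p.μ))
      else if b = ⟨p.src.shift p.ν, p.μ⟩ then
        (I * η : ℂ) • ((ContinuousLinearMap.proj (R := ℂ) (φ := fun _ : Site (PV d ℓ i.m i.K hd hL) 0 => 𝔸) p.src).comp
          (ContinuousLinearMap.proj (R := ℂ) (φ := fun _ : Fin (d + 1) => Site (PV d ℓ i.m i.K hd hL) 0 → 𝔸) p.ν))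
      else 0,
    fun p b => ?_, fun a p b => ?_⟩
  · dsimp only
    split_ifs
    · refine (norm_smul_eval_le i _ p.μ p.src).trans (le_of_eq ?_)
      rw [norm_mul, Complex.norm_I, one_mul, Complex.norm_real, Real.norm_eq_abs]
    · refine (norm_smul_eval_le i _ p.ν p.src).trans (le_of_eq ?_)
      rw [norm_mul, Complex.norm_I, one_mul, Complex.norm_real, Real.norm_eq_abs]
    · exact le_trans (le_of_eq ContinuousLinearMap.opNorm_zero) (abs_nonneg η)
  · rw [curlT_prodCfg]
    dsimp only
    split_ifs <;> rfl

variable [NormOneClass 𝔸] {K₀ : ℝ}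

open Classical in
/-- The background assignment `gradT i U₀` is bounded by `K₀` once `‖U₀(b)‖ ≤ K₀`, `1 ≤ K₀` (its values are `U₀(b)` or `1`).
[cite: Balaban1985BackgroundPropagators, (3.3) p.390, (3.35) p.396] -/
theorem norm_gradT_le (hU : ∀ μ x, ‖(U₀ μ x : 𝔸)‖ ≤ K₀) (hK1 : 1 ≤ K₀) (b : FBondY i) (z : SiteY i) :
    ‖(gradT i U₀ b z : 𝔸)‖ ≤ K₀ := by
  unfold gradT
  split_ifs
  · exact hU b.dir b.src
  · rw [Units.val_one, norm_one]; exact hK1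

open Classical in
/-- … and so is its inverse once `‖U₀(b)⁻¹‖ ≤ K₀`. [cite: Balaban1985BackgroundPropagators, (3.5) p.391, (3.35) p.396] -/
theorem norm_gradT_inv_le (hUi : ∀ μ x, ‖(((U₀ μ x)⁻¹ : 𝔸ˣ) : 𝔸)‖ ≤ K₀) (hK1 : 1 ≤ K₀) (b : FBondY i) (z : SiteY i) :
    ‖(((gradT i U₀ b z)⁻¹ : 𝔸ˣ) : 𝔸)‖ ≤ K₀ := by
  unfold gradT
  split_ifs
  · exact hUi b.dir b.src
  · rw [inv_one, Units.val_one, norm_one]; exact hK1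

open Classical in
/-- The background assignment `curlT i U₀` is bounded by `K₀` once `‖U₀(b)‖ ≤ K₀`, `1 ≤ K₀`. [cite: Balaban1985BackgroundPropagators, (3.4) p.391, (3.35) p.396] -/
theorem norm_curlT_le (hU : ∀ μ x, ‖(U₀ μ x : 𝔸)‖ ≤ K₀) (hK1 : 1 ≤ K₀) (p : PlaqY i) (b : FBondY i) :
    ‖(curlT i U₀ p b : 𝔸)‖ ≤ K₀ := by
  unfold curlT
  split_ifs
  · exact hU p.μ p.src
  · exact hU p.ν p.src
  · rw [Units.val_one, norm_one]; exact hK1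

open Classical in
/-- … and so is its inverse once `‖U₀(b)⁻¹‖ ≤ K₀`. [cite: Balaban1985BackgroundPropagators, (3.5) p.391, (3.4) p.391] -/
theorem norm_curlT_inv_le (hUi : ∀ μ x, ‖(((U₀ μ x)⁻¹ : 𝔸ˣ) : 𝔸)‖ ≤ K₀) (hK1 : 1 ≤ K₀) (p : PlaqY i) (b : FBondY i) :
    ‖(((curlT i U₀ p b)⁻¹ : 𝔸ˣ) : 𝔸)‖ ≤ K₀ := by
  unfold curlT
  split_ifs
  · exact hUi p.μ p.src
  · exact hUi p.ν p.src
  · rw [inv_one, Units.val_one, norm_one]; exact hK1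

end Values

/-! ## §2. The four facts per assignment along the pencil: holomorphy and bounds of values and inverses -/

section Facts

variable (U₀ : CfgY 𝔸 i) (η : ℝ) {Rc K₀ : ℝ}

/-- `A′ ↦ gradT i (prodCfg U₀ η A′) b z` is holomorphic on every ball. [cite: Balaban1985BackgroundPropagators, (3.3) p.390, Thm 3.4 and (3.50) p.400] -/
theorem differentiableOn_gradT_prodCfg (b : FBondY i) (z : SiteY i) :
    DifferentiableOn ℂ (fun a => (gradT i (prodCfg U₀ η a) b z : 𝔸))
      (ball (0 : Fin (d + 1) → Site (PV d ℓ i.m i.K hd hL) 0 → 𝔸) Rc) := by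
  obtain ⟨L, -, hT⟩ := exists_pencil_gradT i U₀ η
  exact differentiableOn_pencil L (gradT i U₀) (fun a => gradT i (prodCfg U₀ η a)) hT b z

/-- `A′ ↦ (gradT i (prodCfg U₀ η A′) b z)⁻¹` is holomorphic on every ball. [cite: Balaban1985BackgroundPropagators, (3.5) p.391, Thm 3.4 p.400] -/
theorem differentiableOn_gradT_inv_prodCfg (b : FBondY i) (z : SiteY i) :
    DifferentiableOn ℂ (fun a => (((gradT i (prodCfg U₀ η a) b z)⁻¹ : 𝔸ˣ) : 𝔸))
      (ball (0 : Fin (d + 1) → Site (PV d ℓ i.m i.K hd hL) 0 → 𝔸) Rc) := by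
  obtain ⟨L, -, hT⟩ := exists_pencil_gradT i U₀ η
  exact differentiableOn_pencil_inv L (gradT i U₀) (fun a => gradT i (prodCfg U₀ η a)) hT b z

/-- `A′ ↦ curlT i (prodCfg U₀ η A′) p b` is holomorphic on every ball. [cite: Balaban1985BackgroundPropagators, (3.4) p.391, Thm 3.4 p.400] -/
theorem differentiableOn_curlT_prodCfg (p : PlaqY i) (b : FBondY i) :
    DifferentiableOn ℂ (fun a => (curlT i (prodCfg U₀ η a) p b : 𝔸))
      (ball (0 : Fin (d + 1) → Site (PV d ℓ i.m i.K hd hL) 0 → 𝔸) Rc) := by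
  obtain ⟨L, -, hT⟩ := exists_pencil_curlT i U₀ η
  exact differentiableOn_pencil L (curlT i U₀) (fun a => curlT i (prodCfg U₀ η a)) hT p b

/-- `A′ ↦ (curlT i (prodCfg U₀ η A′) p b)⁻¹` is holomorphic on every ball. [cite: Balaban1985BackgroundPropagators, (3.5) p.391, Thm 3.4 p.400] -/
theorem differentiableOn_curlT_inv_prodCfg (p : PlaqY i) (b : FBondY i) :
    DifferentiableOn ℂ (fun a => (((curlT i (prodCfg U₀ η a) p b)⁻¹ : 𝔸ˣ) : 𝔸))
      (ball (0 : Fin (d + 1) → Site (PV d ℓ i.m i.K hd hL) 0 → 𝔸) Rc) := by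
  obtain ⟨L, -, hT⟩ := exists_pencil_curlT i U₀ η
  exact differentiableOn_pencil_inv L (curlT i U₀) (fun a => curlT i (prodCfg U₀ η a)) hT p b

variable [NormOneClass 𝔸]

/-- On `‖A′‖ < R`: `‖gradT i (prodCfg U₀ η A′) b z‖ ≤ K₀e^{|η|R}` once `‖U₀(b)‖ ≤ K₀`, `1 ≤ K₀`.
[cite: Balaban1985BackgroundPropagators, (3.3) p.390, (3.35)–(3.37) p.396, Thm 3.4 p.400] -/
theorem norm_gradT_prodCfg_le (hU : ∀ μ x, ‖(U₀ μ x : 𝔸)‖ ≤ K₀) (hK1 : 1 ≤ K₀) (hRc : 0 ≤ Rc) :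
    ∀ a ∈ ball (0 : Fin (d + 1) → Site (PV d ℓ i.m i.K hd hL) 0 → 𝔸) Rc, ∀ b z,
      ‖(gradT i (prodCfg U₀ η a) b z : 𝔸)‖ ≤ K₀ * Real.exp (|η| * Rc) := by
  obtain ⟨L, hL, hT⟩ := exists_pencil_gradT i U₀ η
  exact norm_pencil_le L (gradT i U₀) (fun a => gradT i (prodCfg U₀ η a)) hT hL (norm_gradT_le i U₀ hU hK1) hRc

/-- On `‖A′‖ < R`: `‖(gradT i (prodCfg U₀ η A′) b z)⁻¹‖ ≤ K₀e^{|η|R}` once `‖U₀(b)⁻¹‖ ≤ K₀`, `1 ≤ K₀`.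
[cite: Balaban1985BackgroundPropagators, (3.5) p.391, (3.35)–(3.37) p.396, Thm 3.4 p.400] -/
theorem norm_gradT_inv_prodCfg_le (hUi : ∀ μ x, ‖(((U₀ μ x)⁻¹ : 𝔸ˣ) : 𝔸)‖ ≤ K₀) (hK1 : 1 ≤ K₀) (hRc : 0 ≤ Rc) :
    ∀ a ∈ ball (0 : Fin (d + 1) → Site (PV d ℓ i.m i.K hd hL) 0 → 𝔸) Rc, ∀ b z,
      ‖(((gradT i (prodCfg U₀ η a) b z)⁻¹ : 𝔸ˣ) : 𝔸)‖ ≤ K₀ * Real.exp (|η| * Rc) := by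
  obtain ⟨L, hL, hT⟩ := exists_pencil_gradT i U₀ η
  exact norm_pencil_inv_le L (gradT i U₀) (fun a => gradT i (prodCfg U₀ η a)) hT hL (norm_gradT_inv_le i U₀ hUi hK1) hRc

/-- On `‖A′‖ < R`: `‖curlT i (prodCfg U₀ η A′) p b‖ ≤ K₀e^{|η|R}` once `‖U₀(b)‖ ≤ K₀`, `1 ≤ K₀`.
[cite: Balaban1985BackgroundPropagators, (3.4) p.391, (3.35)–(3.37) p.396, Thm 3.4 p.400] -/
theorem norm_curlT_prodCfg_le (hU : ∀ μ x, ‖(U₀ μ x : 𝔸)‖ ≤ K₀) (hK1 : 1 ≤ K₀) (hRc : 0 ≤ Rc) :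
    ∀ a ∈ ball (0 : Fin (d + 1) → Site (PV d ℓ i.m i.K hd hL) 0 → 𝔸) Rc, ∀ p b,
      ‖(curlT i (prodCfg U₀ η a) p b : 𝔸)‖ ≤ K₀ * Real.exp (|η| * Rc) := by
  obtain ⟨L, hL, hT⟩ := exists_pencil_curlT i U₀ η
  exact norm_pencil_le L (curlT i U₀) (fun a => curlT i (prodCfg U₀ η a)) hT hL (norm_curlT_le i U₀ hU hK1) hRc

/-- On `‖A′‖ < R`: `‖(curlT i (prodCfg U₀ η A′) p b)⁻¹‖ ≤ K₀e^{|η|R}` once `‖U₀(b)⁻¹‖ ≤ K₀`, `1 ≤ K₀`.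
[cite: Balaban1985BackgroundPropagators, (3.5) p.391, (3.4) p.391, Thm 3.4 p.400] -/
theorem norm_curlT_inv_prodCfg_le (hUi : ∀ μ x, ‖(((U₀ μ x)⁻¹ : 𝔸ˣ) : 𝔸)‖ ≤ K₀) (hK1 : 1 ≤ K₀) (hRc : 0 ≤ Rc) :
    ∀ a ∈ ball (0 : Fin (d + 1) → Site (PV d ℓ i.m i.K hd hL) 0 → 𝔸) Rc, ∀ p b,
      ‖(((curlT i (prodCfg U₀ η a) p b)⁻¹ : 𝔸ˣ) : 𝔸)‖ ≤ K₀ * Real.exp (|η| * Rc) := by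
  obtain ⟨L, hL, hT⟩ := exists_pencil_curlT i U₀ η
  exact norm_pencil_inv_le L (curlT i U₀) (fun a => curlT i (prodCfg U₀ η a)) hT hL (norm_curlT_inv_le i U₀ hUi hK1) hRc

end Facts

/-! ## §3. ★ The four letters' coordinates along the pencil, in the N10 currency -/

section Coordinates

variable (U₀ : CfgY 𝔸 i) (η : ℝ) {κ : Type} (φ : κ → 𝔸 →L[ℂ] ℂ) (e : κ → 𝔸) {Rc K₀ : ℝ}

/-- ★ **`D_U` (3.3) ALONG THE PENCIL — HOLOMORPHY**: every coordinate `A′ ↦ gradK(b,z)·φ_k(R(gradT i (e^{iηA′}U₀) b z) e_l)` of NODE 00's covariant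
gradient is holomorphic on every chart ball. [cite: Balaban1985BackgroundPropagators, (3.3) p.390, Thm 3.4 and (3.50) p.400] -/
theorem differentiableOn_coord_gradY_prodCfg (b : FBondY i) (z : SiteY i) (k l : κ) :
    DifferentiableOn ℂ (fun a => ((gradK i b z : ℝ) : ℂ) * φ k (R (gradT i (prodCfg U₀ η a) b z) (e l)))
      (ball (0 : Fin (d + 1) → Site (PV d ℓ i.m i.K hd hL) 0 → 𝔸) Rc) :=
  differentiableOn_coord_trLift (gradK i) (fun a => gradT i (prodCfg U₀ η a)) φ e
    (differentiableOn_gradT_prodCfg i U₀ η) (differentiableOn_gradT_inv_prodCfg i U₀ η) b z k l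

/-- ★ **`D_U` (3.3) ALONG THE PENCIL — BOUND** on `‖A′‖ < R`: `≤ |gradK(b,z)|·‖φ_k‖·(K₀e^{|η|R}·‖e_l‖·K₀e^{|η|R})` once `‖U₀(b)^{±1}‖ ≤ K₀`, `1 ≤ K₀`.
[cite: Balaban1985BackgroundPropagators, (3.3) p.390, Thm 3.4 p.400, (3.108) p.416] -/
theorem norm_coord_gradY_prodCfg_le [NormOneClass 𝔸] (hU : ∀ μ x, ‖(U₀ μ x : 𝔸)‖ ≤ K₀)
    (hUi : ∀ μ x, ‖(((U₀ μ x)⁻¹ : 𝔸ˣ) : 𝔸)‖ ≤ K₀) (hK1 : 1 ≤ K₀) (hRc : 0 ≤ Rc)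
    {a : Fin (d + 1) → Site (PV d ℓ i.m i.K hd hL) 0 → 𝔸} (ha : a ∈ ball 0 Rc) (b : FBondY i) (z : SiteY i) (k l : κ) :
    ‖((gradK i b z : ℝ) : ℂ) * φ k (R (gradT i (prodCfg U₀ η a) b z) (e l))‖ ≤
      |gradK i b z| * (‖φ k‖ * (K₀ * Real.exp (|η| * Rc) * ‖e l‖ * (K₀ * Real.exp (|η| * Rc)))) :=
  norm_coord_trLift_le (gradK i) (fun a => gradT i (prodCfg U₀ η a)) φ e (norm_gradT_prodCfg_le i U₀ η hU hK1 hRc)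
    (norm_gradT_inv_prodCfg_le i U₀ η hUi hK1 hRc) ha b z k l

/-- ★ **`D_U` (3.3) ALONG THE PENCIL — IDENTIFICATION**: the coordinate family IS `φ_k` of NODE 00's `gradY i (prodCfg U₀ η A′)` on the one-site field
`δ_z ⊗ e_l`, read at the bond `b`. [cite: Balaban1985BackgroundPropagators, (3.3) p.390, (3.50) p.400] -/
theorem coord_gradY_prodCfg_eq (a : Fin (d + 1) → Site (PV d ℓ i.m i.K hd hL) 0 → 𝔸) (b : FBondY i) (z : SiteY i) (k l : κ) :
    ((gradK i b z : ℝ) : ℂ) * φ k (R (gradT i (prodCfg U₀ η a) b z) (e l)) =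
      φ k (gradY i (prodCfg U₀ η a) (Pi.single z (e l)) b) :=
  coord_trLift_eq_coord_trLiftY (gradK i) (fun a => gradT i (prodCfg U₀ η a)) φ e a b z k l

/-- ★ **`D*_U` (3.8) ALONG THE PENCIL — HOLOMORPHY** (the divergence carries the INVERTED transporters `(gradT i U b z)⁻¹`): every coordinate
`A′ ↦ divK(z,b)·φ_k(R((gradT i (e^{iηA′}U₀) b z)⁻¹) e_l)` is holomorphic on every chart ball. [cite: Balaban1985BackgroundPropagators, (3.8) p.392, (3.5) p.391, Thm 3.4 p.400] -/
theorem differentiableOn_coord_divY_prodCfg (z : SiteY i) (b : FBondY i) (k l : κ) :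
    DifferentiableOn ℂ (fun a => ((divK i z b : ℝ) : ℂ) * φ k (R ((gradT i (prodCfg U₀ η a) b z)⁻¹) (e l)))
      (ball (0 : Fin (d + 1) → Site (PV d ℓ i.m i.K hd hL) 0 → 𝔸) Rc) := by
  refine differentiableOn_coord_trLift (divK i) (fun a z b => (gradT i (prodCfg U₀ η a) b z)⁻¹) φ e
    (fun z b => differentiableOn_gradT_inv_prodCfg i U₀ η b z) (fun z b => ?_) z b k l
  simpa only [inv_inv] using differentiableOn_gradT_prodCfg i U₀ η (Rc := Rc) b z

/-- ★ **`D*_U` (3.8) ALONG THE PENCIL — BOUND** on `‖A′‖ < R`: `≤ |divK(z,b)|·‖φ_k‖·(K₀e^{|η|R}·‖e_l‖·K₀e^{|η|R})`.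
[cite: Balaban1985BackgroundPropagators, (3.8) p.392, Thm 3.4 p.400, (3.108) p.416] -/
theorem norm_coord_divY_prodCfg_le [NormOneClass 𝔸] (hU : ∀ μ x, ‖(U₀ μ x : 𝔸)‖ ≤ K₀)
    (hUi : ∀ μ x, ‖(((U₀ μ x)⁻¹ : 𝔸ˣ) : 𝔸)‖ ≤ K₀) (hK1 : 1 ≤ K₀) (hRc : 0 ≤ Rc)
    {a : Fin (d + 1) → Site (PV d ℓ i.m i.K hd hL) 0 → 𝔸} (ha : a ∈ ball 0 Rc) (z : SiteY i) (b : FBondY i) (k l : κ) :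
    ‖((divK i z b : ℝ) : ℂ) * φ k (R ((gradT i (prodCfg U₀ η a) b z)⁻¹) (e l))‖ ≤
      |divK i z b| * (‖φ k‖ * (K₀ * Real.exp (|η| * Rc) * ‖e l‖ * (K₀ * Real.exp (|η| * Rc)))) := by
  refine norm_coord_trLift_le (divK i) (fun a z b => (gradT i (prodCfg U₀ η a) b z)⁻¹) φ e
    (fun a ha z b => norm_gradT_inv_prodCfg_le i U₀ η hUi hK1 hRc a ha b z) (fun a ha z b => ?_) ha z b k l
  simpa only [inv_inv] using norm_gradT_prodCfg_le i U₀ η hU hK1 hRc a ha b z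

/-- ★ **`D*_U` (3.8) ALONG THE PENCIL — IDENTIFICATION** with `φ_k` of NODE 00's `divY i (prodCfg U₀ η A′)` on `δ_b ⊗ e_l`, read at the site `z`.
[cite: Balaban1985BackgroundPropagators, (3.8) p.392] -/
theorem coord_divY_prodCfg_eq (a : Fin (d + 1) → Site (PV d ℓ i.m i.K hd hL) 0 → 𝔸) (z : SiteY i) (b : FBondY i) (k l : κ) :
    ((divK i z b : ℝ) : ℂ) * φ k (R ((gradT i (prodCfg U₀ η a) b z)⁻¹) (e l)) =
      φ k (divY i (prodCfg U₀ η a) (Pi.single b (e l)) z) :=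
  coord_trLift_eq_coord_trLiftY (divK i) (fun a z b => (gradT i (prodCfg U₀ η a) b z)⁻¹) φ e a z b k l

/-- ★ **THE COVARIANT CURL (3.4) ALONG THE PENCIL — HOLOMORPHY**: every coordinate `A′ ↦ curlK(p,b)·φ_k(R(curlT i (e^{iηA′}U₀) p b) e_l)` of NODE 00's
`curlY` is holomorphic on every chart ball. [cite: Balaban1985BackgroundPropagators, (3.4) p.391, Thm 3.4 p.400] -/
theorem differentiableOn_coord_curlY_prodCfg (p : PlaqY i) (b : FBondY i) (k l : κ) :
    DifferentiableOn ℂ (fun a => ((curlK i p b : ℝ) : ℂ) * φ k (R (curlT i (prodCfg U₀ η a) p b) (e l)))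
      (ball (0 : Fin (d + 1) → Site (PV d ℓ i.m i.K hd hL) 0 → 𝔸) Rc) :=
  differentiableOn_coord_trLift (curlK i) (fun a => curlT i (prodCfg U₀ η a)) φ e
    (differentiableOn_curlT_prodCfg i U₀ η) (differentiableOn_curlT_inv_prodCfg i U₀ η) p b k l

/-- ★ **THE COVARIANT CURL (3.4) ALONG THE PENCIL — BOUND** on `‖A′‖ < R`: `≤ |curlK(p,b)|·‖φ_k‖·(K₀e^{|η|R}·‖e_l‖·K₀e^{|η|R})`.
[cite: Balaban1985BackgroundPropagators, (3.4) p.391, Thm 3.4 p.400, (3.108) p.416] -/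
theorem norm_coord_curlY_prodCfg_le [NormOneClass 𝔸] (hU : ∀ μ x, ‖(U₀ μ x : 𝔸)‖ ≤ K₀)
    (hUi : ∀ μ x, ‖(((U₀ μ x)⁻¹ : 𝔸ˣ) : 𝔸)‖ ≤ K₀) (hK1 : 1 ≤ K₀) (hRc : 0 ≤ Rc)
    {a : Fin (d + 1) → Site (PV d ℓ i.m i.K hd hL) 0 → 𝔸} (ha : a ∈ ball 0 Rc) (p : PlaqY i) (b : FBondY i) (k l : κ) :
    ‖((curlK i p b : ℝ) : ℂ) * φ k (R (curlT i (prodCfg U₀ η a) p b) (e l))‖ ≤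
      |curlK i p b| * (‖φ k‖ * (K₀ * Real.exp (|η| * Rc) * ‖e l‖ * (K₀ * Real.exp (|η| * Rc)))) :=
  norm_coord_trLift_le (curlK i) (fun a => curlT i (prodCfg U₀ η a)) φ e (norm_curlT_prodCfg_le i U₀ η hU hK1 hRc)
    (norm_curlT_inv_prodCfg_le i U₀ η hUi hK1 hRc) ha p b k l

/-- ★ **THE COVARIANT CURL (3.4) ALONG THE PENCIL — IDENTIFICATION** with `φ_k` of NODE 00's `curlY i (prodCfg U₀ η A′)` on `δ_b ⊗ e_l`, read at `p`.
[cite: Balaban1985BackgroundPropagators, (3.4) p.391] -/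
theorem coord_curlY_prodCfg_eq (a : Fin (d + 1) → Site (PV d ℓ i.m i.K hd hL) 0 → 𝔸) (p : PlaqY i) (b : FBondY i) (k l : κ) :
    ((curlK i p b : ℝ) : ℂ) * φ k (R (curlT i (prodCfg U₀ η a) p b) (e l)) =
      φ k (curlY i (prodCfg U₀ η a) (Pi.single b (e l)) p) :=
  coord_trLift_eq_coord_trLiftY (curlK i) (fun a => curlT i (prodCfg U₀ η a)) φ e a p b k l

/-- ★ **THE CURL's ADJOINT (3.9) ALONG THE PENCIL — HOLOMORPHY** (inverted transporters `(curlT i U p b)⁻¹`): every coordinate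
`A′ ↦ cocurlK(b,p)·φ_k(R((curlT i (e^{iηA′}U₀) p b)⁻¹) e_l)` is holomorphic on every chart ball. [cite: Balaban1985BackgroundPropagators, (3.9) p.392, (3.5) p.391, Thm 3.4 p.400] -/
theorem differentiableOn_coord_coCurlY_prodCfg (b : FBondY i) (p : PlaqY i) (k l : κ) :
    DifferentiableOn ℂ (fun a => ((cocurlK i b p : ℝ) : ℂ) * φ k (R ((curlT i (prodCfg U₀ η a) p b)⁻¹) (e l)))
      (ball (0 : Fin (d + 1) → Site (PV d ℓ i.m i.K hd hL) 0 → 𝔸) Rc) := by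
  refine differentiableOn_coord_trLift (cocurlK i) (fun a b p => (curlT i (prodCfg U₀ η a) p b)⁻¹) φ e
    (fun b p => differentiableOn_curlT_inv_prodCfg i U₀ η p b) (fun b p => ?_) b p k l
  simpa only [inv_inv] using differentiableOn_curlT_prodCfg i U₀ η (Rc := Rc) p b

/-- ★ **THE CURL's ADJOINT (3.9) ALONG THE PENCIL — BOUND** on `‖A′‖ < R`: `≤ |cocurlK(b,p)|·‖φ_k‖·(K₀e^{|η|R}·‖e_l‖·K₀e^{|η|R})`.
[cite: Balaban1985BackgroundPropagators, (3.9) p.392, Thm 3.4 p.400, (3.108) p.416] -/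
theorem norm_coord_coCurlY_prodCfg_le [NormOneClass 𝔸] (hU : ∀ μ x, ‖(U₀ μ x : 𝔸)‖ ≤ K₀)
    (hUi : ∀ μ x, ‖(((U₀ μ x)⁻¹ : 𝔸ˣ) : 𝔸)‖ ≤ K₀) (hK1 : 1 ≤ K₀) (hRc : 0 ≤ Rc)
    {a : Fin (d + 1) → Site (PV d ℓ i.m i.K hd hL) 0 → 𝔸} (ha : a ∈ ball 0 Rc) (b : FBondY i) (p : PlaqY i) (k l : κ) :
    ‖((cocurlK i b p : ℝ) : ℂ) * φ k (R ((curlT i (prodCfg U₀ η a) p b)⁻¹) (e l))‖ ≤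
      |cocurlK i b p| * (‖φ k‖ * (K₀ * Real.exp (|η| * Rc) * ‖e l‖ * (K₀ * Real.exp (|η| * Rc)))) := by
  refine norm_coord_trLift_le (cocurlK i) (fun a b p => (curlT i (prodCfg U₀ η a) p b)⁻¹) φ e
    (fun a ha b p => norm_curlT_inv_prodCfg_le i U₀ η hUi hK1 hRc a ha p b) (fun a ha b p => ?_) ha b p k l
  simpa only [inv_inv] using norm_curlT_prodCfg_le i U₀ η hU hK1 hRc a ha p b

/-- ★ **THE CURL's ADJOINT (3.9) ALONG THE PENCIL — IDENTIFICATION** with `φ_k` of NODE 00's `coCurlY i (prodCfg U₀ η A′)` on `δ_p ⊗ e_l`, read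
at the bond `b`. [cite: Balaban1985BackgroundPropagators, (3.9) p.392] -/
theorem coord_coCurlY_prodCfg_eq (a : Fin (d + 1) → Site (PV d ℓ i.m i.K hd hL) 0 → 𝔸) (b : FBondY i) (p : PlaqY i) (k l : κ) :
    ((cocurlK i b p : ℝ) : ℂ) * φ k (R ((curlT i (prodCfg U₀ η a) p b)⁻¹) (e l)) =
      φ k (coCurlY i (prodCfg U₀ η a) (Pi.single p (e l)) b) :=
  coord_trLift_eq_coord_trLiftY (cocurlK i) (fun a b p => (curlT i (prodCfg U₀ η a) p b)⁻¹) φ e a b p k l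

end Coordinates

/-! ## §4. The real point `A′ = 0` -/

section RealPoint

/-- **AT `A′ = 0` THE PENCIL IS THE BACKGROUND**: `prodCfg U₀ η 0 = U₀` — every statement above, at `A′ = 0`, is about NODE 00's letter at the
background `U₀` itself. [cite: Balaban1985BackgroundPropagators, p.390 («U = U′U₀»), p.395 («It coincides with Δ_a in (2.19) if U = 1»)] -/
theorem prodCfg_zero' (U₀ : CfgY 𝔸 i) (η : ℝ) :
    prodCfg U₀ η (0 : Fin (d + 1) → Site (PV d ℓ i.m i.K hd hL) 0 → 𝔸) = U₀ := by
  funext μ x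
  ext
  rw [val_prodCfg, Pi.zero_apply, Pi.zero_apply, smul_zero, NormedSpace.exp_zero, one_mul]

end RealPoint

end Literature.MathematicalPhysics.QuantumFieldTheory.Balaban1983to89.B13OpsYPencilLetters

end
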